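import Summits.BirchSwinnertonDyer.BirchSwinnertonDyer.Theorems.SchneiderFreeAdditiveX3GordTwoBranchIMCDivOfKY
import Literature.NumberTheory.EllipticCurves.KellerYin2024.PotentiallyGoodOrdinaryIwasawaTheoryBranch
import Literature.NumberTheory.EllipticCurves.QuadraticTwistLFunctionProofs
import Literature.NumberTheory.EllipticCurves.LFunctionSmulProofs
import Literature.NumberTheory.LFunctions.DworkRationalitySplittingSeries
import HarnessLib

/-!
# Route `SchneiderFreeAdditiveX3` (K1 door), crux `GordTwoBranchIMC` (stmt-BirchSwinnertonDyer-19177):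
# H3 at the frame READ FROM Keller–Yin Thm. 3.5.1 IN BRANCH CURRENCY — the frame is Castella–Hsieh's
# `χ_ε`-branch `L`-function of the GOOD-ORDINARY member `f̃ = f_{W′}` (no translation `f̃ ⊗ ε ↔ f`)

Cell `bsd-schneider-ideate` (HOME `run/shared/lean/pub/bsd-schneider-ideate/`), seat `door-c3` gen 9.
PARTITION: board row B6 ∩ X3 ∩ sst-twist, r = 1, (G-ord, `e = 2`) half (2 560 of 7 101 pairs) of
`Rank1Residual.partition`; types-the-object-of the divisibility input of crux r3's record in the
currency in which it is PRINTED; closes nothing (the crux stays OPEN behind the preprint claim; BSD is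
not advanced). HONEST FRAMING: theorems only, CONDITIONAL on the two typed Keller–Yin PREPRINT claims
(`thm351_imc_isTorsion_mu_zero_charIdeal_eq_OPEN` for (i) torsion and (ii) `μ(𝔛) = 0` at the good
member; `thm351_charIdeal_eq_branch_OPEN` — Thm. 3.5.1 (iii) over branch frames, landed p492331 — for
the equality) and, in §4, on the PUBLISHED Castella–Hsieh existence fact
`castellaHsieh2018_exists_isBranchBDPLFunction` (Math. Ann. 370 (2018) Def. 3.7 + Prop. 3.8, p489390).

WHY (door-c3 gen 8 FINDING `door-c3-g8-branch-currency.md`): the registered stub `stub_CH = KYReadCH`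
asks for a Castella-shape frame `IsBDPLFunction ι′ 𝔭′ κ γ Dt.f …` for the ADDITIVE curve's newform
`Dt.f` — neither printed nor derivable in the tree (local–global compatibility of the avatar at `𝔭′`).
The printed object is Castella–Hsieh's measure for `f̃ = Dt′.f` (the good-ordinary partner `W′`,
`p ∤ N_{W′}`) on the `χ_ε`-branch, `χ_ε = KellerYin2024.genusHeckeCharacter K p`: a BRANCH frame
`IsBranchBDPLFunction ι′ 𝔭′ κ γ Dt′.f χ_ε e Ω_K Ω_p L` (`BDPBranchPAdicLFunction.lean`, p486242). This
file is door-c3 gen 7's `xac_charIdeal_map_le_of_KY_OPEN` (`…DivOfKY.lean`) RE-KEYED to that frame: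

* §1 `not_C_dvd_of_firstUnitCoeffAt` — a `μ = 0` series is not divisible by `p` (bookkeeping);
* §2 `exists_cofinite_cuspCoeff_eq_legendreSym_mul` — the twist relation "`f = f̃ ⊗ ε`" of the branch
  claim, `a_ℓ(Dt.f) = (ℓ/p)·a_ℓ(Dt′.f)` for every prime `ℓ ≠ p`, PROVED for the door's presentation
  `W = C₂ • ((D • W′) ⊗ χ_{p*})` from the tree theorems `LFunction_quadraticTwist_pStar_apply`
  (Rubin–Silverberg / Silverman X) and `LFunction_smul`;
* §3 `exists_frame_xac_charIdeal_map_le_of_KY_branch_OPEN` — H3 at the frame: from ANY branch frame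
  `(e ≠ 0, Ω_K ≠ 0, Ω_p ≠ 0, L)` of `(Dt′.f, χ_ε)` AT the conjugate prime `𝔭′` (induced by `ι′`), the
  good member `W₁ →_φ W` and the two KY claims: a branch frame `L₀ = L/p^c` with the SAME periods,
  `¬ p ∣ L₀`, and `Ch_Λ(X_ac^∅(W_K))·R₀⟦T⟧ ⊆ (L₀)` at the socket's prime `𝔭` — the slack is removed by
  the Literature lemma `exists_frame_firstUnitCoeff_charIdeal_eq_of_branch_OPEN` (no `μ`-clause, no
  Tate constant), the descent along `φ` is gen 4/5's `xac_charIdeal_map_le_of_ratIsogeny`;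
* §4 `exists_branchFrame_xac_charIdeal_map_le_of_castellaHsieh` — the same with the frame SUPPLIED by
  the Castella–Hsieh fact: inputs are the door's socket data, the good member, `p ∤ N′` and Heegner
  for the partner's level `N′`, a parametrisation datum `Dt′` of `W′`, the two KY claims, the CH fact,
  and ONE remaining hypothesis
  `hcond` — the conductor exponent of `χ_ε` is exactly `1` above `p` (local class field theory for
  `ψ_ε = HeckeCharacter.ofDirichlet ε`; asked of the typer lane, P2 g13 STATUS 03:08Z); `χ_ε² = 1` and
  unramified-off-`p` are the Literature theorems `genusHeckeCharacter_sq` / `_isUnramifiedAt`.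

So H1 ∧ H3 of the (G-ord, `e = 2`) road are now BY NAME modulo {PUB fact, PRE claim ×2, `hcond`};
what remains of `stub_CH` is the VALUE half alone (Castella–Hsieh Thm. 5.7 + Lemma 5.4 at a `μ = 0`
branch frame; cite item wi-73260), consumed by the sibling assembly `…GordTwoBranchIMCOfKYBranch.lean`.

References: Keller–Yin arXiv:2410.23241 §3.1 Prop. 3.1.3, §3.4, Thm. 3.5.1, Rem. 3.5.2; Castella–Hsieh,
Math. Ann. 370 (2018) §3.3, Def. 3.7, Prop. 3.8; Castella, Camb. J. Math. 6 (2018) Def. 2.2;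
Rubin–Silverberg 2002 §1 (twisting `a_ℓ`); Washington §7.1 (μ as first unit coefficient).
-/

noncomputable section

open scoped Classical

open WeierstrassCurve NumberField IsDedekindDomain Field PowerSeries
  Literature.NumberTheory.EllipticCurves
  Literature.NumberTheory.EllipticCurves.ModularForms
  Literature.NumberTheory.EllipticCurves.GreenbergSelmer
  Literature.NumberTheory.EllipticCurves.Rank1Residual
  Literature.NumberTheory.EllipticCurves.KellerYin2024
  Literature.NumberTheory.GaloisRepresentations
  Summit.BirchSwinnertonDyer.Rank1Residual
  Summit.BirchSwinnertonDyer.Rank1Residual.X11b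
  Summit.BirchSwinnertonDyer.Rank1Residual.X11b.AcSelmer
  Summit.BirchSwinnertonDyer.Rank1Residual.X11b.Halves
open Literature.NumberTheory.LFunctions.Dwork (norm_natCast_p_padicComplex)

-- D-0017 layout: summit = sub-problem, so `Summit.BirchSwinnertonDyer.BirchSwinnertonDyer.…` is the
-- mandated namespace (same option as the route's sockets files).
set_option linter.dupNamespace false
set_option autoImplicit false

namespace Summit.BirchSwinnertonDyer.BirchSwinnertonDyer.Theorems.SchneiderFree

/-! ## §1 A `μ = 0` series is not divisible by `p` -/

/-- If the `n`-th coefficient of `L ∈ R₀⟦T⟧` is a unit (`FirstUnitCoeffAt L n`, "`μ(L) = 0`,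
`λ(L) = n`"), then `p ∤ L` in `R₀⟦T⟧` (every coefficient of `p·M` has norm `≤ p⁻¹ < 1`).
[cite: Washington1997, §7.1 Prop. 7.2 (μ = 0 as a unit coefficient)] -/
theorem not_C_dvd_of_firstUnitCoeffAt {p : ℕ} [Fact p.Prime] {L : UnrSeries p} {n : ℕ}
    (h : FirstUnitCoeffAt L n) : ¬ C (p : unrIntegers p) ∣ L := by
  rintro ⟨M, rfl⟩
  have h1 := h.1
  rw [PowerSeries.coeff_C_mul, Subring.coe_mul, norm_mul, Subring.coe_natCast,
    norm_natCast_p_padicComplex] at h1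
  have hle : (p : ℝ)⁻¹ * ‖((coeff n M : unrIntegers p) : ℂ_[p])‖ ≤ (p : ℝ)⁻¹ * 1 :=
    mul_le_mul_of_nonneg_left (norm_coe_unrIntegers_le_one p _) (by positivity)
  rw [h1, mul_one] at hle
  have hlt : (p : ℝ)⁻¹ < 1 :=
    inv_lt_one_of_one_lt₀ (by exact_mod_cast (Fact.out : p.Prime).one_lt)
  exact absurd hle (not_le.mpr hlt)

/-! ## §2 The twist relation `a_ℓ(f) = (ℓ/p)·a_ℓ(f̃)` for the door's presentation -/

/-- **"`f = f̃ ⊗ ε`" for the door's presentation, coefficientwise off `p`.** For the presented door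
curve `W = C₂ • ((D • W′) ⊗ χ_{p*})` with parametrisation data `Dt` (of `W`, level `N`) and `Dt′` (of
`W′`): `a_ℓ(Dt.f) = (ℓ/p)·a_ℓ(Dt′.f)` for every prime `ℓ ≠ p` — `a_n(Dt.f) = a_n(W)` (`IsNewformOf`),
`a_n` is a `ℚ`-isomorphism invariant (`LFunction_smul`), `a_ℓ(V ⊗ χ_{p*}) = (p*/ℓ)·a_ℓ(V) = (ℓ/p)·a_ℓ(V)`
(`LFunction_quadraticTwist_pStar_apply`). This is the cofinite twist hypothesis of
`KellerYin2024.thm351_charIdeal_eq_branch_OPEN` with `S = {p}`.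
[cite: RubinSilverberg2002, §1 (a_ℓ of a quadratic twist)] -/
theorem exists_cofinite_cuspCoeff_eq_legendreSym_mul {p : ℕ} [Fact p.Prime] (hp2 : p ≠ 2)
    (W' : WeierstrassCurve ℚ) [W'.IsElliptic] (D C₂ : VariableChange ℚ)
    [(C₂ • (D • W').quadraticTwist ((-1 : ℚ) ^ (p / 2) * p)).IsElliptic]
    {N N' : ℕ} [NeZero N] [NeZero N']
    (Dt : ModularParametrizationData (C₂ • (D • W').quadraticTwist ((-1 : ℚ) ^ (p / 2) * p)) N)
    (Dt' : ModularParametrizationData W' N') :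
    ∃ S : Finset ℕ, ∀ ℓ : ℕ, ℓ.Prime → ℓ ∉ S →
      cuspCoeff Dt.f ℓ = ((legendreSym p ℓ : ℤ) : ℂ) * cuspCoeff Dt'.f ℓ := by
  refine ⟨{p}, fun ℓ _ hℓS ↦ ?_⟩
  have hℓp : ¬ p ∣ ℓ := by
    intro h
    rcases (Nat.dvd_prime ‹ℓ.Prime›).mp h with h1 | h1
    · exact (Fact.out : p.Prime).one_lt.ne' h1
    · exact hℓS (Finset.mem_singleton.mpr h1.symm)
  have hd0 : ((-1 : ℚ) ^ (p / 2) * p) ≠ 0 :=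
    mul_ne_zero (pow_ne_zero _ (by norm_num)) (by exact_mod_cast (Fact.out : p.Prime).ne_zero)
  haveI : ((D • W').quadraticTwist ((-1 : ℚ) ^ (p / 2) * p)).IsElliptic :=
    (D • W').isElliptic_quadraticTwist hd0
  have hcast : (((-1 : ℤ) ^ (p / 2) * p : ℤ) : ℚ) = (-1 : ℚ) ^ (p / 2) * p := by push_cast; ring
  have htw := (D • W').LFunction_quadraticTwist_pStar_apply hp2 hℓp
  rw [hcast] at htw
  rw [Dt.isNewformOf.2 ℓ, Dt'.isNewformOf.2 ℓ, WeierstrassCurve.LFunction_smul, htw,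
    WeierstrassCurve.LFunction_smul]
  push_cast
  ring

/-! ## §3 H3 at the frame from ANY branch frame at the conjugate prime (Keller–Yin, branch currency) -/

/-- **H3 at the frame ⇐ Keller–Yin Thm. 3.5.1 (i)(ii) ∧ (iii-branch) + a good member + ANY branch frame
of `(f̃, χ_ε)` at `𝔭′`.** Data: an elliptic `W/ℚ` with newform `f` of level `N`; the partner's
newform `f′` of level `N′`, `p ∤ N′`, with the cofinite twist relation `a_ℓ(f) = (ℓ/p) a_ℓ(f′)`; an
imaginary quadratic `K` of odd discriminant `≠ −3` satisfying the Heegner hypothesis for `N`; an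
anticyclotomic `κ` with topological generator `γ`; the socket's degree-one prime `𝔭 ∋ p` (`p` odd),
its conjugate `𝔭′ ≠ 𝔭` and an embedding datum `ι′` inducing `𝔭′`; a BRANCH frame
`IsBranchBDPLFunction ι′ 𝔭′ κ γ f′ χ_ε e Ω_K Ω_p L` with `e, Ω_K, Ω_p ≠ 0` (no `μ`-condition); a good
member `W₁ →_φ W` (degree `p^m d`, `p ∤ d`, conductor `N`, Case (I), `Red`, KY's lattice normalisation,
`W₁(K)[p] = 0`); torsion of the target module (CTL₀). CONCLUSION: a branch frame `L₀` with constant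
`e₀ ≠ 0` and the SAME periods, with `¬ p ∣ L₀` and `Ch_Λ(X_ac^∅(W_K))·R₀⟦T⟧ ⊆ (L₀)` (strict at `𝔭`).
Proof: `PotOrdSetting ι′ W₁ K 𝔭′ 𝔭 κ N`; `f` is the newform of `W₁`; the branch claim self-improves the
frame to `μ = 0` with the equality (`exists_frame_firstUnitCoeff_charIdeal_eq_of_branch_OPEN`); KY (i)(ii)
for `W₁`; descent along `φ`. CONDITIONAL on the two OPEN preprint claims; nothing asserted about BSD.
[cite: KellerYin2024b, Thm. 3.5.1 and Rem. 3.5.2 (arXiv:2410.23241 p. 20) (preprint; hypotheses)]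
[cite: CastellaHsieh2018, Def. 3.7 and Prop. 3.8 (the branch frame; = arXiv v1 Def. 3.5 / Prop. 3.6)] -/
theorem exists_frame_xac_charIdeal_map_le_of_KY_branch_OPEN
    (hKY : thm351_imc_isTorsion_mu_zero_charIdeal_eq_OPEN) (hKYb : thm351_charIdeal_eq_branch_OPEN)
    {p : ℕ} [hp : Fact p.Prime] (hp2 : p ≠ 2)
    {W : WeierstrassCurve ℚ} [W.IsElliptic] {N : ℕ} [NeZero N]
    {f : CuspForm (CongruenceSubgroup.Gamma0 N) 2} (hfW : IsNewformOf W f)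
    -- the good-ordinary member of the Heegner pair, by its newform
    {N' : ℕ} [NeZero N'] {f' : CuspForm (CongruenceSubgroup.Gamma0 N') 2} (hf' : IsNewform0 f')
    (hpN' : ¬ p ∣ N')
    (htw : ∃ S : Finset ℕ, ∀ ℓ : ℕ, ℓ.Prime → ℓ ∉ S →
      cuspCoeff f ℓ = ((legendreSym p ℓ : ℤ) : ℂ) * cuspCoeff f' ℓ)
    {K : Type} [Field K] [NumberField K] [IsGalois ℚ K] (hK : IsImaginaryQuadratic K)
    (hHe : SatisfiesHeegnerHypothesis N K) (hodd : Odd (NumberField.discr K))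
    (hdK : NumberField.discr K ≠ -3)
    {κ : ZpExtension K p} (hκ : κ.IsAnticyclotomic) (γ : absoluteGaloisGroup K)
    [Fact (κ.IsTopGenerator γ)]
    {𝔭 : HeightOneSpectrum (𝓞 K)} (h𝔭 : ((p : ℕ) : 𝓞 K) ∈ 𝔭.asIdeal)
    (he : 𝔭.asIdeal.ramificationIdx (𝓞 ℚ) = 1) (hf : 𝔭.asIdeal.inertiaDeg (𝓞 ℚ) = 1)
    {𝔭' : HeightOneSpectrum (𝓞 K)} (hne : 𝔭 ≠ 𝔭') {ι' : PadicAlgCl p ≃+* ℂ}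
    (hι' : BranchInducesPrime p ι' 𝔭')
    -- ANY branch frame of `(f′, χ_ε)` at `𝔭′`
    {e : ℂ} {ΩK : ℂ} {Ωp : ℂ_[p]} {L : UnrSeries p} (he0 : e ≠ 0) (hΩK : ΩK ≠ 0) (hΩp : Ωp ≠ 0)
    (hL : IsBranchBDPLFunction ι' 𝔭' κ γ f' (genusHeckeCharacter K p) e ΩK Ωp L)
    -- the good member of the isogeny class
    {W₁ : WeierstrassCurve ℚ} [W₁.IsElliptic] [W₁.IsGloballyMinimal]
    (φ : WeierstrassCurve.Isogeny W₁ W) {m d : ℕ} (hdeg : φ.degree = p ^ m * d) (hd : ¬ p ∣ d)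
    (hN₁ : W₁.conductorNorm ℤ = N) (hcase₁ : W₁.HasGoodOrdinaryReductionOverQuadraticAt p)
    (hred₁ : Red W₁ p)
    (hlat₁ : ∃ Φ : AddSubgroup (geomTorsion W₁ (p : ℤ)),
      IsRationalLine W₁ p Φ ∧ ¬ LineDecompositionTrivialAt W₁ p Φ)
    (htf₁ : ∀ Q : (W₁.baseChange K).toAffine.Point, p • Q = 0 → Q = 0)
    -- torsion of the target module (on the door: the control corner's CTL₀)
    (hT : Module.IsTorsion (IwasawaAlgebra p) (XAc (W.baseChange K) p κ 𝔭 ∅ γ)) :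
    ∃ (e₀ : ℂ) (L₀ : UnrSeries p), e₀ ≠ 0 ∧
      IsBranchBDPLFunction ι' 𝔭' κ γ f' (genusHeckeCharacter K p) e₀ ΩK Ωp L₀ ∧
      ¬ C (p : unrIntegers p) ∣ L₀ ∧
      (XAc.charIdeal (W.baseChange K) p κ 𝔭 ∅ γ).map (PowerSeries.map (toUnr p)) ≤
        Ideal.span {L₀} := by
  -- Keller–Yin's standing data for the good member, at `(v, v̄) := (𝔭′, 𝔭)`
  have hS : PotOrdSetting ι' W₁ K 𝔭' 𝔭 κ N :=
    potOrdSetting_of_socketData hp2 ι' W₁ K 𝔭 𝔭' κ N hN₁ hcase₁ hred₁ hlat₁ htf₁ hK hHe hodd hdK hκ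
      h𝔭 he hf hne hι'
  -- `f` is the newform of `W₁`
  have hf₁ : IsNewformOf W₁ f := hfW.of_isIsogenous ⟨φ⟩
  -- Thm. 3.5.1 (i)(ii) for `W₁`
  obtain ⟨hT₁, hμ₁, -⟩ := hKY ι' W₁ K 𝔭' 𝔭 κ γ hf₁ hS
  -- Thm. 3.5.1 (iii) in branch currency: a `μ = 0` frame `L₀ = L/p^c` with the equality
  obtain ⟨e₀, L₀, he₀, hL₀, hfu, heq⟩ :=
    exists_frame_firstUnitCoeff_charIdeal_eq_of_branch_OPEN hKYb ι' W₁ K 𝔭' 𝔭 κ γ hf₁ hS hf' hpN'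
      htw he0 hΩK hΩp hL (toUnr p) (coe_toUnr p)
  refine ⟨e₀, L₀, he₀, hL₀, not_C_dvd_of_firstUnitCoeffAt hfu, ?_⟩
  have hdiv₁ : (XAc.charIdeal (W₁.baseChange K) p κ 𝔭 ∅ γ).map (PowerSeries.map (toUnr p)) ≤
      Ideal.span {L₀} := by
    rw [xac_charIdeal_eq_literature, heq]
  -- descend along the isogeny (finite generation is unconditional; torsion of the target = `hT`)
  haveI : Module.Finite (IwasawaAlgebra p) (XAc (W₁.baseChange K) p κ 𝔭 ∅ γ) :=
    Literature.NumberTheory.EllipticCurves.Castella2018.AcSelmer.XAc.module_finite_empty _ p κ 𝔭 γ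
  haveI : Module.Finite (IwasawaAlgebra p) (XAc (W.baseChange K) p κ 𝔭 ∅ γ) :=
    Literature.NumberTheory.EllipticCurves.Castella2018.AcSelmer.XAc.module_finite_empty _ p κ 𝔭 γ
  exact xac_charIdeal_map_le_of_ratIsogeny κ 𝔭 ∅ γ φ hdeg hd hT₁ hT hμ₁ (PowerSeries.map (toUnr p))
    hdiv₁

/-! ## §4 H1 ∧ H3 at the frame: the branch frame SUPPLIED by Castella–Hsieh (published) -/

/-- **H1 ∧ H3 at the frame ⇐ Castella–Hsieh Prop. 3.8 (PUBLISHED) ∧ Keller–Yin Thm. 3.5.1 (PREPRINT, (i)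
(ii) and (iii-branch)) ∧ `hcond`.** For the door's presented curve `W = C₂ • ((D • W′) ⊗ χ_{p*})`
(`W′` good ordinary at `p`, parametrisation data `Dt` of level `N` and `Dt′` of `W′`) at a socket datum
with `d_K ≠ −3`, the socket's degree-one `𝔭 ∋ p`, its conjugate `𝔭′` and an `ι′` inducing `𝔭′`, a good
member `W₁ →_φ W`, CTL₀: THERE IS a branch frame `(e₀ ≠ 0, Ω_K ≠ 0, Ω_p ∈ R₀^×, L₀)` of `(Dt′.f, χ_ε)`
at `𝔭′` with `¬ p ∣ L₀` and `Ch_Λ(X_ac^∅(W_K))·R₀⟦T⟧ ⊆ (L₀)` at `𝔭`. The frame is the Castella–Hsieh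
fact at `(W′, Dt′.f, χ_ε)`: its hypotheses `p ∤ N′` and Heegner for `N′` are inputs here (on the door:
good reduction of `W′` at `p`, and `N_{W′} ∣ N` by `conductorNorm_partner_dvd_level`), `χ_ε² = 1` and
unramified off `p` are the Literature theorems; its third branch-character hypothesis — conductor exponent exactly `1` above `p` — is the explicit input
`hcond` (local class field theory for `ψ_ε`, owed by the typer lane). The twist relation is §2.
CONDITIONAL on one published fact, two preprint claims and `hcond`; nothing asserted about BSD.
[cite: CastellaHsieh2018, Def. 3.7 and Prop. 3.8 (= arXiv v1 Def. 3.5 / Prop. 3.6)]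
[cite: KellerYin2024b, Thm. 3.5.1 and Rem. 3.5.2 (arXiv:2410.23241 p. 20) (preprint; hypotheses)] -/
theorem exists_branchFrame_xac_charIdeal_map_le_of_castellaHsieh
    (hCHx : castellaHsieh2018_exists_isBranchBDPLFunction)
    (hKY : thm351_imc_isTorsion_mu_zero_charIdeal_eq_OPEN) (hKYb : thm351_charIdeal_eq_branch_OPEN)
    -- the prime, the good partner `W′`, the presentation of the door's curve
    {p : ℕ} [hp : Fact p.Prime] (hp2 : p ≠ 2) (W' : WeierstrassCurve ℚ) [W'.IsElliptic]
    (D C₂ : VariableChange ℚ) [(C₂ • (D • W').quadraticTwist ((-1 : ℚ) ^ (p / 2) * p)).IsElliptic]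
    {N : ℕ} [NeZero N]
    (Dt : ModularParametrizationData (C₂ • (D • W').quadraticTwist ((-1 : ℚ) ^ (p / 2) * p)) N)
    {N' : ℕ} [NeZero N'] (Dt' : ModularParametrizationData W' N') (hpN' : ¬ p ∣ N')
    -- the socket's field, tower, primes, embedding datum; Heegner for `N` and for the partner's level
    {K : Type} [Field K] [NumberField K] [IsGalois ℚ K] (hK : IsImaginaryQuadratic K)
    (hHe : SatisfiesHeegnerHypothesis N K) (hHe' : SatisfiesHeegnerHypothesis N' K)
    (hodd : Odd (NumberField.discr K))
    (hdK : NumberField.discr K ≠ -3)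
    {κ : ZpExtension K p} (hκ : κ.IsAnticyclotomic) (γ : absoluteGaloisGroup K)
    [hγ : Fact (κ.IsTopGenerator γ)]
    {𝔭 : HeightOneSpectrum (𝓞 K)} (h𝔭 : ((p : ℕ) : 𝓞 K) ∈ 𝔭.asIdeal)
    (he : 𝔭.asIdeal.ramificationIdx (𝓞 ℚ) = 1) (hf : 𝔭.asIdeal.inertiaDeg (𝓞 ℚ) = 1)
    {𝔭' : HeightOneSpectrum (𝓞 K)} (h𝔭' : ((p : ℕ) : 𝓞 K) ∈ 𝔭'.asIdeal) (hne : 𝔭 ≠ 𝔭')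
    {ι' : PadicAlgCl p ≃+* ℂ} (hι' : BranchInducesPrime p ι' 𝔭')
    -- the conductor exponent of `χ_ε` above `p` (owed: local class field theory for `ψ_ε`)
    (hcond : ∀ 𝔮 : HeightOneSpectrum (𝓞 K), ((p : ℕ) : 𝓞 K) ∈ 𝔮.asIdeal →
      (genusHeckeCharacter K p).HasConductorExponentAt 𝔮 1)
    -- the good member of the isogeny class
    {W₁ : WeierstrassCurve ℚ} [W₁.IsElliptic] [W₁.IsGloballyMinimal]
    (φ : WeierstrassCurve.Isogeny W₁ (C₂ • (D • W').quadraticTwist ((-1 : ℚ) ^ (p / 2) * p)))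
    {m d : ℕ} (hdeg : φ.degree = p ^ m * d) (hd : ¬ p ∣ d)
    (hN₁ : W₁.conductorNorm ℤ = N) (hcase₁ : W₁.HasGoodOrdinaryReductionOverQuadraticAt p)
    (hred₁ : Red W₁ p)
    (hlat₁ : ∃ Φ : AddSubgroup (geomTorsion W₁ (p : ℤ)),
      IsRationalLine W₁ p Φ ∧ ¬ LineDecompositionTrivialAt W₁ p Φ)
    (htf₁ : ∀ Q : (W₁.baseChange K).toAffine.Point, p • Q = 0 → Q = 0)
    -- torsion of the target module (on the door: the control corner's CTL₀)
    (hT : Module.IsTorsion (IwasawaAlgebra p)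
      (XAc ((C₂ • (D • W').quadraticTwist ((-1 : ℚ) ^ (p / 2) * p)).baseChange K) p κ 𝔭 ∅ γ)) :
    ∃ (e₀ : ℂ) (ΩK : ℂ) (Ωp : (unrIntegers p)ˣ) (L₀ : UnrSeries p), e₀ ≠ 0 ∧ ΩK ≠ 0 ∧
      IsBranchBDPLFunction ι' 𝔭' κ γ Dt'.f (genusHeckeCharacter K p) e₀ ΩK
        ((Ωp : unrIntegers p) : ℂ_[p]) L₀ ∧
      ¬ C (p : unrIntegers p) ∣ L₀ ∧
      (XAc.charIdeal ((C₂ • (D • W').quadraticTwist ((-1 : ℚ) ^ (p / 2) * p)).baseChange K)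
          p κ 𝔭 ∅ γ).map (PowerSeries.map (toUnr p)) ≤ Ideal.span {L₀} := by
  -- the hypotheses of the Castella–Hsieh fact at `(W′, Dt′.f, χ_ε)`, frame at `𝔭′`
  have hsplit : ((Ideal.span {(p : ℤ)}).primesOver (𝓞 K)).ncard = 2 :=
    ncard_primesOver_eq_two_of_degreeOne hK.1 h𝔭 he hf
  obtain ⟨e, ΩK, Ωp, L, he0, hΩK, hL⟩ := hCHx ι' W' K 𝔭' κ γ Dt'.isNewformOf
    (genusHeckeCharacter K p) hp2 hpN' hK hsplit h𝔭' hι' hHe' hκ hγ.out (genusHeckeCharacter_sq K p)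
    (fun w hw ↦ genusHeckeCharacter_isUnramifiedAt K p hw) hcond
  have hΩp : ((Ωp : unrIntegers p) : ℂ_[p]) ≠ 0 := by
    rw [Ne, ZeroMemClass.coe_eq_zero]
    exact Ωp.ne_zero
  obtain ⟨e₀, L₀, he₀, hL₀, hμ₀, hdiv⟩ :=
    exists_frame_xac_charIdeal_map_le_of_KY_branch_OPEN hKY hKYb hp2 Dt.isNewformOf Dt'.isNewformOf.1
      hpN' (exists_cofinite_cuspCoeff_eq_legendreSym_mul hp2 W' D C₂ Dt Dt') hK hHe hodd hdK hκ γ h𝔭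
      he hf hne hι' he0 hΩK hΩp hL φ hdeg hd hN₁ hcase₁ hred₁ hlat₁ htf₁ hT
  exact ⟨e₀, ΩK, Ωp, L₀, he₀, hΩK, hL₀, hμ₀, hdiv⟩

end Summit.BirchSwinnertonDyer.BirchSwinnertonDyer.Theorems.SchneiderFree

end
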